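import Summits.QuantumFields.YangMills.Theorems.FluctuationComparisonRegPrIntLS2BetaEtaFactorisation
import Summits.QuantumFields.YangMills.Theorems.FluctuationComparisonRegPrIntLS2BetaSmallBondGaugeToronObstruction
import HarnessLib

/-!
# S2β · Q11f — THE DISCREPANCY `ε_b = R_b⁻¹·η_b` OF AN INTRA-BLOCK BOND IS A PURE LADDER: `dist1` AND ARC (`‖logVec ∘ su2Quat‖`) EDITIONS IN THE `W·U⁻¹` READING OF THE ONE-PROFILE ROW
# (any torus in standing range; any `GaugeGroup` for `dist1`, `SU(2)` for the arc; any averaging family, abstract `lift`∕`g`∕`g₀` under (T4))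

Cell `ym3-torus` (rung R3 = continuum `SU(2)` YM₃ on T³ at fixed lattice data — NOT d = 4, NOT infinite volume, NOT a mass gap, NOT Clay).  Width seat `ym3-torus-px5` (gen 23);
crux `stmt-QuantumFields-20520`, LINE g18-1 S2β; LIFT-LADDER″ — ONE-PROFILE after the architect's rulings 19:24:49Z (ii) ∕ 19:37:59Z (1)–(3): per `B`, every bond `b` of `READ′_{t+1}(B)` has main
part the relative LIFT `R_b := A_W b·(A_U b)⁻¹` and DISCREPANCY `ε_b := R_b⁻¹·η_b`, `η_b := W_t b·(U_t b)⁻¹` (px20 g24 ⧗`…LiftLadderFaceRow`'s currency: `‖𝟙_{pS}·logVec η‖² ≤ (1+κ)(c∕L)²·‖𝟙_{pT}·logVec η_parent‖² +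
(1+κ⁻¹)·s²` from a discrepancy letter `‖logVec (su2Quat (R_b⁻¹·η_b))‖ ≤ s` on the `pS`-bonds off the tree comb).  THIS FILE supplies that discrepancy letter for the INTRA-BLOCK bonds:
§1 `R_b⁻¹·η_b = U_t b·ε̃_b·(U_t b)⁻¹` with `ε̃_b := (A_W b·(A_U b)⁻¹·U_t b)⁻¹·W_t b` = Q11e's ε (a conjugation — no commutator, no smallness), so `dist1` and the arc agree; §2 Q11e ✓p832282
`dist1_eps_le_of_intraBlock_stage` ⟹ `dist1 (R_b⁻¹·η_b) ≤ (Σ_{ν<e}|(y − emb B)_ν|)·ρ̃`; §3 on `SU(2)`, Jordan (✓`norm_logVec_le_pi_div_two_mul_dist1`):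
`‖logVec (su2Quat (R_b⁻¹·η_b))‖ ≤ (π∕2)·(Σ_{ν<e}|(y − emb B)_ν|)·ρ̃ ≤ (π∕2)·(e·((L−1)∕2))·ρ̃` — the `s` of the row for intra-block bonds, EVERY level.  `--kind proof --supports stmt-QuantumFields-20520
--as helper`, count-neutral, DEFINITION-FREE (0 `def`, 0 `instance`, 0 `notation`, 0 `sorry`, default heartbeats); generic `P : Params` (standing range), ANY `av`, abstract `lift g g₀`
under (4b)'s (T4) readings `hT4`∕`hT4'`; `ρ̃` = the relative-plaquette sup of `(W_t, W̃)` on the block (px12 g26 (d): `ρ̃ ≤ ρ_{t+1} + lift curvature + feedback` — NOT here).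

WHAT IS PROVED (sorry-free).
* §1 `inv_relLift_mul_chord_eq_conj` (any group), `dist1_disc_eq_dist1_eps` (any `GaugeGroup`), `norm_logVec_disc_eq_norm_logVec_eps` (`SU(2)`, ✓`norm_logVec_su2Quat_conj`).
* §2 ★★★`dist1_disc_le_of_intraBlock_stage` — `dist1 ((A_W b·(A_U b)⁻¹)⁻¹·(W_t b·(U_t b)⁻¹)) ≤ (Σ_{ν<e}|rel (emb B) y ν|)·ρ̃` for `b = ⟨y,e⟩`, `y, y+e ∈ B`.
* §3 ★★★`norm_logVec_disc_le_of_intraBlock_stage` (`SU(2)`; `≤ (π∕2)·(Σ…)·ρ̃`), ★`norm_logVec_disc_le_of_intraBlock_stage_crude` (`≤ (π∕2)·(e·((L−1)∕2))·ρ̃`).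

HONEST SCOPE.  Group∕lattice bookkeeping over landed lemmas; nothing of Bałaban's analysis is asserted or proved; the face-crossing bonds' discrepancy (px20∕px17 RULING (i)), `ρ̃`'s bound, the
per-`B` row assembly and READ′ aggregation are NOT here; COMB-ROW′∕NC-ROW′∕(TOP-LAD′)∕(SCT′)∕(ST′)∕(ST), LOC's discharge, «MULT♭-ax»∕«CRIT-ax», (D-stage), h3, GAP♯∘ (`stub_uniformFibreGapOrbit`,
registry 3732b7df UNTOUCHED, 0∕5), S2β, the five registered stubs, 20520, 19936, 19200, `YM3TorusSU2` NOT proved; no summit statement is proved by a helper; rung R3 — NOT d = 4, NOT infinite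
volume, NOT a mass gap, NOT Clay; the Yang–Mills mass gap is NOT proved.

References: T. Bałaban, CMP **102** (1985) 277–309 [Balaban1985RegularSpaces] ((1.19) p.79, (1.29) p.81); CMP **98** (1985) 17–51 [Balaban1985Averaging] ((58) p.27); CMP **122** (1989)
355–392 [Balaban1989LargeFieldII] (p.382).
-/

set_option autoImplicit false

namespace Summit.QuantumFields.YangMills.Theorems.FluctuationComparisonRegPrIntLS2BetaDiscrepancyIntraBlock

open scoped Real
open Literature.MathematicalPhysics.QuantumLattice (su2Quat)
open Literature.MathematicalPhysics.QuantumFieldTheory.Balaban1983to89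
open Literature.MathematicalPhysics.QuantumFieldTheory.Balaban1983to89.T4Continuum
open Literature.MathematicalPhysics.QuantumFieldTheory.Balaban1983to89.BlockAveraging
open T4CubeChartGnomonic (SU2)
open T4ExpWindowSmallField (logVec)
open B10Eq27TorusAxialLog (rel axialT)
open Summit.QuantumFields.YangMills.Theorems.FluctuationComparisonRegPrIntLS2BetaEtaFactorisation (dist1_eps_le_of_intraBlock_stage)
open Summit.QuantumFields.YangMills.Theorems.FluctuationComparisonRegPrIntLS2BetaSmallBondGaugeToronObstruction (norm_logVec_su2Quat_conj)
open Summit.QuantumFields.YangMills.Theorems.FluctuationComparisonRegPrIntLS2BetaDistributedHolonomySU2 (norm_logVec_le_pi_div_two_mul_dist1)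
open Summit.QuantumFields.YangMills.Theorems.FluctuationComparisonRegPrIntLS2BetaIterAxialGaugeOneLevel (natAbs_rel_emb_le)

variable {P : Params} {G : Type*} [GaugeGroup G]

/-! ## §1 `R⁻¹·η` is a conjugate of Q11e's `ε` -/

/-- `(a_W·a_U⁻¹)⁻¹·(w·u⁻¹) = u·((a_W·a_U⁻¹·u)⁻¹·w)·u⁻¹` in any group: the one-profile row's discrepancy `R⁻¹η` (all chords read `X·X₀⁻¹`) is the conjugate by `u` of Q11e's `ε = W̃⁻¹·W`.
[cite: Balaban1985RegularSpaces, (1.19) p.79 (bookkeeping)] -/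
theorem inv_relLift_mul_chord_eq_conj {H : Type*} [Group H] (aU aW u w : H) :
    (aW * aU⁻¹)⁻¹ * (w * u⁻¹) = u * ((aW * aU⁻¹ * u)⁻¹ * w) * u⁻¹ := by
  group

/-- Hence the two discrepancies have the same `dist1`. [cite: Balaban1985RegularSpaces, (1.19) p.79 (bookkeeping)] -/
theorem dist1_disc_eq_dist1_eps (aU aW u w : G) :
    dist1 ((aW * aU⁻¹)⁻¹ * (w * u⁻¹)) = dist1 ((aW * aU⁻¹ * u)⁻¹ * w) := by
  rw [inv_relLift_mul_chord_eq_conj, GaugeGroup.dist1_conj]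

/-- … and, on `SU(2)`, the same arc `‖logVec ∘ su2Quat‖`. [cite: Balaban1985RegularSpaces, (1.19) p.79 (bookkeeping)] -/
theorem norm_logVec_disc_eq_norm_logVec_eps (aU aW u w : SU2) :
    ‖logVec (su2Quat ((aW * aU⁻¹)⁻¹ * (w * u⁻¹)))‖ = ‖logVec (su2Quat ((aW * aU⁻¹ * u)⁻¹ * w))‖ := by
  rw [inv_relLift_mul_chord_eq_conj, norm_logVec_su2Quat_conj]

/-! ## §2 The `dist1` discrepancy letter on intra-block bonds (any `GaugeGroup`) -/

/-- ★★★ **THE DISCREPANCY OF AN INTRA-BLOCK BOND IS A PURE LADDER (`dist1`)**: with `W_t = g j • iter j U`, `U_t = g₀ j • iter j U₁`, `A_W = lift j (g (j+1) • iter (j+1) U)`,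
`A_U = lift j (g₀ (j+1) • iter (j+1) U₁)` under (T4) and `ρ̃` bounding the relative plaquettes of `(W_t, A_W·A_U⁻¹·U_t)` on the block `B`: for `b = ⟨y, e⟩` with `y, y + e ∈ B`,
`dist1 ((A_W b·(A_U b)⁻¹)⁻¹·(W_t b·(U_t b)⁻¹)) ≤ (Σ_{ν<e} |(y − emb B)_ν|)·ρ̃`. [cite: Balaban1985RegularSpaces, (1.19) p.79; Balaban1989LargeFieldII, p.382] -/
theorem dist1_disc_le_of_intraBlock_stage (av : ∀ i, Averaging P i G) {j : ℕ} (hj : j + 1 ≤ P.m + P.K)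
    (lift : (i : ℕ) → GaugeField P (i + 1) G → GaugeField P i G) (g g₀ : (i : ℕ) → Site P i → G) (U U₁ : GaugeField P 0 G)
    (hT4 : ∀ x, axialT (GaugeField.gaugeAct (g j) (Averaging.iter av j U)) (emb (blockOf x)) x =
      axialT (lift j (GaugeField.gaugeAct (g (j + 1)) (Averaging.iter av (j + 1) U))) (emb (blockOf x)) x)
    (hT4' : ∀ x, axialT (GaugeField.gaugeAct (g₀ j) (Averaging.iter av j U₁)) (emb (blockOf x)) x =
      axialT (lift j (GaugeField.gaugeAct (g₀ (j + 1)) (Averaging.iter av (j + 1) U₁))) (emb (blockOf x)) x)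
    (B : Site P (j + 1)) {ρt : ℝ} (hρ0 : 0 ≤ ρt)
    (hρ : ∀ q : Plaq P j, blockOf q.src = B →
      dist1 ((GaugeField.plaqHol (fun b => lift j (GaugeField.gaugeAct (g (j + 1)) (Averaging.iter av (j + 1) U)) b *
            (lift j (GaugeField.gaugeAct (g₀ (j + 1)) (Averaging.iter av (j + 1) U₁)) b)⁻¹ *
          GaugeField.gaugeAct (g₀ j) (Averaging.iter av j U₁) b : GaugeField P j G) q)⁻¹ *
        GaugeField.plaqHol (GaugeField.gaugeAct (g j) (Averaging.iter av j U)) q) ≤ ρt)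
    (y : Site P j) (e' : Fin P.d) (hy : blockOf y = B) (hye : blockOf (y.shift e') = B) :
    dist1 ((lift j (GaugeField.gaugeAct (g (j + 1)) (Averaging.iter av (j + 1) U)) ⟨y, e'⟩ *
            (lift j (GaugeField.gaugeAct (g₀ (j + 1)) (Averaging.iter av (j + 1) U₁)) ⟨y, e'⟩)⁻¹)⁻¹ *
        (GaugeField.gaugeAct (g j) (Averaging.iter av j U) ⟨y, e'⟩ * (GaugeField.gaugeAct (g₀ j) (Averaging.iter av j U₁) ⟨y, e'⟩)⁻¹)) ≤
      (∑ ν ∈ Finset.univ.filter (fun ν => ν < e'), (rel (emb B) y ν).natAbs) * ρt := by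
  rw [dist1_disc_eq_dist1_eps]
  exact dist1_eps_le_of_intraBlock_stage av hj lift g g₀ U U₁ hT4 hT4' B hρ0 hρ y e' hy hye

/-! ## §3 The arc discrepancy letter on intra-block bonds (`SU(2)`) -/

/-- ★★★ **THE DISCREPANCY OF AN INTRA-BLOCK BOND IS A PURE LADDER (arc, `SU(2)`)**: in the setting of §2 on `SU(2)`,
`‖logVec (su2Quat ((A_W b·(A_U b)⁻¹)⁻¹·(W_t b·(U_t b)⁻¹)))‖ ≤ (π∕2)·(Σ_{ν<e} |(y − emb B)_ν|)·ρ̃` — the `s` of px20 g24's row `sq_pi_norm_trunc_le_of_lift_add_disc(_offComb)` for intra-block bonds.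
[cite: Balaban1985RegularSpaces, (1.19) p.79, (1.29) p.81; Balaban1989LargeFieldII, p.382] -/
theorem norm_logVec_disc_le_of_intraBlock_stage (av : ∀ i, Averaging P i SU2) {j : ℕ} (hj : j + 1 ≤ P.m + P.K)
    (lift : (i : ℕ) → GaugeField P (i + 1) SU2 → GaugeField P i SU2) (g g₀ : (i : ℕ) → Site P i → SU2) (U U₁ : GaugeField P 0 SU2)
    (hT4 : ∀ x, axialT (GaugeField.gaugeAct (g j) (Averaging.iter av j U)) (emb (blockOf x)) x =
      axialT (lift j (GaugeField.gaugeAct (g (j + 1)) (Averaging.iter av (j + 1) U))) (emb (blockOf x)) x)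
    (hT4' : ∀ x, axialT (GaugeField.gaugeAct (g₀ j) (Averaging.iter av j U₁)) (emb (blockOf x)) x =
      axialT (lift j (GaugeField.gaugeAct (g₀ (j + 1)) (Averaging.iter av (j + 1) U₁))) (emb (blockOf x)) x)
    (B : Site P (j + 1)) {ρt : ℝ} (hρ0 : 0 ≤ ρt)
    (hρ : ∀ q : Plaq P j, blockOf q.src = B →
      dist1 ((GaugeField.plaqHol (fun b => lift j (GaugeField.gaugeAct (g (j + 1)) (Averaging.iter av (j + 1) U)) b *
            (lift j (GaugeField.gaugeAct (g₀ (j + 1)) (Averaging.iter av (j + 1) U₁)) b)⁻¹ *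
          GaugeField.gaugeAct (g₀ j) (Averaging.iter av j U₁) b : GaugeField P j SU2) q)⁻¹ *
        GaugeField.plaqHol (GaugeField.gaugeAct (g j) (Averaging.iter av j U)) q) ≤ ρt)
    (y : Site P j) (e' : Fin P.d) (hy : blockOf y = B) (hye : blockOf (y.shift e') = B) :
    ‖logVec (su2Quat ((lift j (GaugeField.gaugeAct (g (j + 1)) (Averaging.iter av (j + 1) U)) ⟨y, e'⟩ *
            (lift j (GaugeField.gaugeAct (g₀ (j + 1)) (Averaging.iter av (j + 1) U₁)) ⟨y, e'⟩)⁻¹)⁻¹ *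
        (GaugeField.gaugeAct (g j) (Averaging.iter av j U) ⟨y, e'⟩ * (GaugeField.gaugeAct (g₀ j) (Averaging.iter av j U₁) ⟨y, e'⟩)⁻¹)))‖ ≤
      π / 2 * ((∑ ν ∈ Finset.univ.filter (fun ν => ν < e'), (rel (emb B) y ν).natAbs) * ρt) := by
  refine (norm_logVec_le_pi_div_two_mul_dist1 _).trans ?_
  exact mul_le_mul_of_nonneg_left (dist1_disc_le_of_intraBlock_stage av hj lift g g₀ U U₁ hT4 hT4' B hρ0 hρ y e' hy hye) (by positivity)

/-- ★ The crude form: `‖logVec (su2Quat (R_b⁻¹·η_b))‖ ≤ (π∕2)·(e·((L−1)∕2))·ρ̃` (`≤ (π∕2)·(L−1)·ρ̃` at `d = 3`). [cite: Balaban1985RegularSpaces, (1.19) p.79; Balaban1987RG1, (0.3) p.252] -/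
theorem norm_logVec_disc_le_of_intraBlock_stage_crude (av : ∀ i, Averaging P i SU2) {j : ℕ} (hj : j + 1 ≤ P.m + P.K)
    (lift : (i : ℕ) → GaugeField P (i + 1) SU2 → GaugeField P i SU2) (g g₀ : (i : ℕ) → Site P i → SU2) (U U₁ : GaugeField P 0 SU2)
    (hT4 : ∀ x, axialT (GaugeField.gaugeAct (g j) (Averaging.iter av j U)) (emb (blockOf x)) x =
      axialT (lift j (GaugeField.gaugeAct (g (j + 1)) (Averaging.iter av (j + 1) U))) (emb (blockOf x)) x)
    (hT4' : ∀ x, axialT (GaugeField.gaugeAct (g₀ j) (Averaging.iter av j U₁)) (emb (blockOf x)) x =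
      axialT (lift j (GaugeField.gaugeAct (g₀ (j + 1)) (Averaging.iter av (j + 1) U₁))) (emb (blockOf x)) x)
    (B : Site P (j + 1)) {ρt : ℝ} (hρ0 : 0 ≤ ρt)
    (hρ : ∀ q : Plaq P j, blockOf q.src = B →
      dist1 ((GaugeField.plaqHol (fun b => lift j (GaugeField.gaugeAct (g (j + 1)) (Averaging.iter av (j + 1) U)) b *
            (lift j (GaugeField.gaugeAct (g₀ (j + 1)) (Averaging.iter av (j + 1) U₁)) b)⁻¹ *
          GaugeField.gaugeAct (g₀ j) (Averaging.iter av j U₁) b : GaugeField P j SU2) q)⁻¹ *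
        GaugeField.plaqHol (GaugeField.gaugeAct (g j) (Averaging.iter av j U)) q) ≤ ρt)
    (y : Site P j) (e' : Fin P.d) (hy : blockOf y = B) (hye : blockOf (y.shift e') = B) :
    ‖logVec (su2Quat ((lift j (GaugeField.gaugeAct (g (j + 1)) (Averaging.iter av (j + 1) U)) ⟨y, e'⟩ *
            (lift j (GaugeField.gaugeAct (g₀ (j + 1)) (Averaging.iter av (j + 1) U₁)) ⟨y, e'⟩)⁻¹)⁻¹ *
        (GaugeField.gaugeAct (g j) (Averaging.iter av j U) ⟨y, e'⟩ * (GaugeField.gaugeAct (g₀ j) (Averaging.iter av j U₁) ⟨y, e'⟩)⁻¹)))‖ ≤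
      π / 2 * (((e'.val * ((P.L - 1) / 2) : ℕ) : ℝ) * ρt) := by
  refine (norm_logVec_disc_le_of_intraBlock_stage av hj lift g g₀ U U₁ hT4 hT4' B hρ0 hρ y e' hy hye).trans ?_
  refine mul_le_mul_of_nonneg_left (mul_le_mul_of_nonneg_right ?_ hρ0) (by positivity)
  have hcount : (Finset.univ.filter (fun ν : Fin P.d => ν < e')).card = e'.val := by
    rw [show (Finset.univ.filter (fun ν : Fin P.d => ν < e')) = Finset.Iio e' by ext ν; simp, Fin.card_Iio]
  have hb : (∑ ν ∈ Finset.univ.filter (fun ν => ν < e'), (rel (emb B) y ν).natAbs) ≤ e'.val * ((P.L - 1) / 2) := by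
    calc (∑ ν ∈ Finset.univ.filter (fun ν => ν < e'), (rel (emb B) y ν).natAbs)
        ≤ ∑ _ν ∈ Finset.univ.filter (fun ν => ν < e'), (P.L - 1) / 2 := Finset.sum_le_sum (fun ν _ => natAbs_rel_emb_le hj hy ν)
      _ = e'.val * ((P.L - 1) / 2) := by rw [Finset.sum_const, hcount, smul_eq_mul]
  exact_mod_cast hb

end Summit.QuantumFields.YangMills.Theorems.FluctuationComparisonRegPrIntLS2BetaDiscrepancyIntraBlock
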